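import Summits.Ventures.PercRepro0.T2Twin
import Summits.Ventures.PercRepro0.HighDClose
import Summits.Ventures.PercRepro0.PcChi

/-!
# LEAN CERTIFICATE of the declared PARTIAL PROOF — version 2 (seat p3; lead RULINGS A 00:59:15Z / C 01:02:09Z)

One kernel-checked theorem on the cell's definitions (`Defs.lean`) whose hypotheses are EXACTLY the route's
named statements not yet kernel-checked, and whose conclusion is the declared content of DECLARATION
PARTIAL PROOF (STATUS 2026-08-25T23:22:09Z): `T2_Planar ∧ THD`, i.e. `θ_2(p_c(2)) = 0 ∧ p_c(2) = ½` and
`∀ d ≥ 11, θ_d(p_c(d)) = 0`; and, given the residual `TMID` as a further hypothesis, the brief's `Target`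
(via `Defs.R0_regime_split`).  This file claims nothing beyond that declaration.

Version 1 (`Certificate.lean`, six hypotheses) stays as accepted; this is a NEW module.  Since v1 the
following inputs have been kernel-checked and are no longer hypotheses: P7 · FKG (`Harris.P7_FKG_holds`),
the crossing bound `hcross` / `hLR` of T2-assembly-p4-v2 §4 Step 2 (p1's P6(a) chain, `T2Twin.hcross_holds`),
and S5 · PC-CHI `p_c^χ(d) = p_c(d)` (`PcChi.pcChi_eq_pc`, from sharpness).

Composition: `T2Twin.T2_Planar_of_P1_P5` (p1) for the planar leg and `HighDClose.THD_of_H1_P3` (p3) for the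
high-dimensional leg, the published triangle condition being transported from the print's point of
evaluation `p_c^χ = sup{χ < ∞}` to the route's `p_c = inf{θ > 0}` by `PcChi.H1_Triangle11_of_chi`
(this is the form `HighDChi.THD_of_H1chi_P3_P5'` composes; it is spelled out here on the landed imports).

Hypotheses left (each a ROUTE statement in its `Defs` form):
* `hH1χ : PcChi.H1_TriangleChi11` — H1 · TRIANGLE-11, PUBLISHED, applied verbatim: Fitzner–van der Hofstad 2017,
  Corollary 1.3 with (1.4), the triangle condition at the print's own `p_c^χ(d) = sup{p : χ_d(p) < ∞}` for every
  `d ≥ 11` (lit-2 typing e6c90240); a print stays a hypothesis;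
* `hP3 : ∀ d, P3_Unique d` — P3 · UNIQUE, assumed: paper-proved here (UNIQUENESS-p6-v1, 297f9bbf), not kernel-checked;
* `hP1 : P1_Harris` — P1 · HARRIS `θ_2(½) = 0`, assumed: paper-proved here (P1-harris-p1-v1, ad8d699a), not kernel-checked;
* `hP5 : ∀ d, P5_Sharpness d` — P5 · SHARPNESS (Corollary S1′ form) in every dimension, assumed: paper-proved here
  (SHARP-p4-v2, 20758359), not kernel-checked; used at `d = 2` (planar leg) and at every `d ≥ 11` (through S5).

No definitions; no axioms beyond the standard three.
-/

namespace Summit.Ventures.PercRepro0.CertificateV2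

open Summit.Ventures.PercRepro0.Defs

/-- **The certificate, v2.** Hypotheses = the route's named statements not yet kernel-checked, in their `Defs`
forms (H1 at the print's `p_c^χ`; P3; P1; P5 in every dimension); conclusion = the declared content of
DECLARATION PARTIAL PROOF: `T2_Planar ∧ THD`. -/
theorem partialProof_of (hH1χ : PcChi.H1_TriangleChi11) (hP3 : ∀ d, P3_Unique d) (hP1 : P1_Harris)
    (hP5 : ∀ d, P5_Sharpness d) : T2_Planar ∧ THD :=
  ⟨T2Twin.T2_Planar_of_P1_P5 hP1 (hP5 2),
    HighD.THD_of_H1_P3 (PcChi.H1_Triangle11_of_chi hH1χ (fun d _ => hP5 d)) hP3⟩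

/-- The brief's `Target` from the same four hypotheses plus the residual `TMID` (by `Defs.R0_regime_split`). -/
theorem target_of (hH1χ : PcChi.H1_TriangleChi11) (hP3 : ∀ d, P3_Unique d) (hP1 : P1_Harris)
    (hP5 : ∀ d, P5_Sharpness d) (hMID : TMID) : Target :=
  R0_regime_split (partialProof_of hH1χ hP3 hP1 hP5).1 (partialProof_of hH1χ hP3 hP1 hP5).2 hMID

end Summit.Ventures.PercRepro0.CertificateV2
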